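import Summits.AtomisticToContinuum.HydrodynamicLimit.Theorems.CollisionIsometryCLTAdaptedWeightCLTTimeLocal
import Literature.Analysis.FluidPDE.HardSphereCollisionRecord
import Literature.Analysis.FluidPDE.BoltzmannEquation

/-!
# Skeleton of the line `approach-cylinder-pullback` for the crux `AdaptedWeightCLT`
(stmt-AtomisticToContinuum-14868, rev-12 TIME-LOCAL form; route `CollisionIsometryCLT`, sub-problem
`HydrodynamicLimit`; planner `planner-cruxplan-stmt-AtomisticToContinuum-14868-approach-cylinder-pu-0`,
card `Cruxes/AdaptedWeightCLT/Ideas/approach-cylinder-pullback.md`, triage r1 pass ×3 AS A RESHAPING, combine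
proposal TRIAGE-r1-3 Panel C: host = cell entropy budget + Donsker–Varadhan + entropy–entropy-production).

## The line in one paragraph
Take the contact statistic OFF the contact set.  For a hard-sphere orbit, a contact of the pair `(i, j)` at time
`τ` with marks `(x_i, ω̂ = (x_i − x_j)/ε, v_i⁻, v_j⁻)` is preceded by a free approach during which, at every
time `s ∈ [τ − r/|g|, τ)` (`g = v_i⁻ − v_j⁻`), the pair is ON COURSE: its minimal-image relative position `ξ` and
relative velocity `g` predict the contact by free flight within look-back LENGTH `r` (`OnCourse`), with the same
marks.  Weighting on-course pairs by `|g|/r` makes the time spent on course count exactly `1` per unintercepted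
contact, so for EVERY mark test `Ψ` the time integral of the BULK functional `bulkPred Ψ` (a sum over ordered
on-course pairs of ONE configuration) equals the contact sum of `Ψ` — exactly, pathwise — up to an explicit
INTERCEPTION BRACKET made of three event sums: contacts whose look-back is cut by an earlier collision of a partner
(or by time `0`) enter with a fraction `< 1` (`contactFrac`), on-course passages FRUSTRATED by a third body
(`frustrated`), and passages still open at the horizon (`tail`).  This is `ConjugacyIdentity` (STUB 1, provable-now
kinematics: CIP 1994 App. 4.A special-flow representation `dz = dσ du`; GST 2013 Prop. 12.3.1).  We take
`r = r_N := (N+1)^{-1/3}` (the inter-particle distance; `ε_N = σ r_N`, mean free path `≍ r_N/σ²`), so on-course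
pairs have positive Liouville measure `≍ σ² × (number of particles)` per snapshot and the interception stratum is
an `O(σ²)`-fraction of the contacts — a fixed stratum at fixed `σ`, which must therefore be SLAVED (second order
in the non-equilibrium amplitude), not merely counted (STUB 2, `LookBackSlavedOn`; the card's excess-count large
deviation is a tool inside it).  The chaos residue is then a statement about ONE TIME SLICE: the bulk on-course
production of the cell entropic test equals its value on the flux-weighted PRODUCT of the cell-local empirical
law, up to a RELATIVE allowance (STUB 3, `CylinderEntropicChaosOn`, THE RESIDUE) — relative to the chaotic
entropic production itself (a coercive, second-order quantity), as Disproof (F4) / TRIAGE r1 force: the absolute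
form is inert at fixed `σ`.  The HOST (STUB 4, `stub_entropicClosure`) is the block-h architecture the panel
identified as the only debt-free one: realised contact production of the cell entropic test telescopes into the
cell-entropy budget `o(N^{4/3})` (exact, convexity remainder `≥ 0`, transport `O(N^{1+γ} log N)` under H2), so
the flux-weighted chaotic entropic production of the cell laws is `o(N^{4/3})`, the entropy–entropy-production
inequality for hard spheres (Rezakhanlou–Villani LNM 1916 Thm 4) and Csiszár–Kullback–Pinsker + uniform
integrability (H2) make the cell kinetic stress and heat flux vanish in `L²ₜ,ₓ`, and the Germano identity lifts
cells to blocks up to the sub-block Reynolds remainder (STUB 5, `SubBlockReynoldsOn`, the declared hydro-class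
remainder shared with card `sustained-anisotropy-superexp`).  H1 (`DiffuseAt`) is OFFERED to stubs 2, 3, 5 and
load-bearing in none (Disproof §1b `named_of_withoutDiffuse`: legitimate); H2 (`TailsOn t`) is used by 2–5.

## Registered stubs (namespace `Holds`; all five are open — bodies `sorry`)
1 `stub_conjugacy`        `∀ σ ∈ (0, ½), ConjugacyIdentity σ`                                   (kinematics, M/L)
2 `stub_lookBack`         `… DiffuseAt → ∀ t > 0, TailsOn t → ∃ c ∈ [0, ½), LookBackSlavedOn c t` given `ConjugacyIdentity σ` (L)
3 `stub_cylinderChaos`    `… DiffuseAt → ∀ t > 0, TailsOn t → ∃ c ∈ [0, ½), CylinderEntropicChaosOn c t`  (XL, hardest)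
4 `stub_entropicClosure`  `∀ σ ∈ (0,½) ∀ Φ ∀ t > 0, TailsOn t → ∀ c ∈ [0, 1), ContactEntropicChaosOn c t → SubBlockReynoldsOn t → ConclOn t` (XL work, theorem-backed)
5 `stub_reynolds`         `… DiffuseAt → ∀ t > 0, TailsOn t → SubBlockReynoldsOn t`            (L, hydro-class)

## Composition (kernel-checked, sorry-free)
`AdaptedWeightCLT_of : stub_conjugacy → stub_lookBack → stub_cylinderChaos → stub_entropicClosure → stub_reynolds →
CollisionIsometryCLT.AdaptedWeightCLT` (D-0027 §3.3 shape; `σ₀ := min (min σ₂ σ₃) (min σ₅ 2⁻¹)`; per horizon `t`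
the triangle inequality + a union bound give `ContactEntropicChaosOn (c_I + c_B) t` from stubs 2 and 3
(`contactEntropicChaosOn_of_lookBack_of_cylinder`, proved), stub 4 closes `ConclOn t`, `cruxTailT_of_conclOn`
and `adaptedWeightCLT_iff` (`Iff.rfl`) give the crux BY NAME).

## Disproof used (`Cruxes/AdaptedWeightCLT/Disproof.lean` v5, cycle 3 = cycle 1 on stmt-14868: NO KILL)
§1: no `_false_without_` theorem exists (F1); H2 is used at stubs 2–5, H1 is offered (WithoutDiffuse shape
legitimate, `named_of_withoutDiffuse`).  (F3) closure debt `chaosCross_tet_ne_zero`: honoured — no moment closure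
anywhere; the host closes through entropy production + EEP on the full mollified cell law.  (F4)/§5c
`CrossNullRelOn`: honoured — every chaos statement here is RELATIVE (allowance `c · ∫∫|chaosEnt|`), never
absolute.  §3 toys I1/I2: moot (no isotropy-from-ipr, no centring).  §5a cradle relay / `CloudLocalityOn`: not
used (no incoherent transport).  §6 dead patterns: all probabilities are `localGibbsLaw`-probabilities of finite
sums / honest integrals along `Φ.flow`; junk values documented at each definition.  No stub is an instance of a
landed Negative lemma (MechanismToys, CubicProbeDeficiency, PreShockSuffices, StubContactCrossNullClosureDebt).
Negatives index: stmt-9218 (`ContactIntensityDomination`, refuted-misstated: a spatial MIXTURE of products is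
not a product) — honoured: the chaotic value `chaosEntAt` is the flux-weighted product of the CELL-LOCAL
(`φc`-weighted) empirical law, never a spatially averaged law.
-/

namespace Summit.AtomisticToContinuum.HydrodynamicLimit.Cruxes.AdaptedWeightCLT.ApproachCylinderPullback

open scoped BigOperators Topology Classical MeasureTheory ENNReal InnerProductSpace
open Filter Set MeasureTheory
open Literature.Analysis.FluidPDE
open Summit.AtomisticToContinuum.HydrodynamicLimit.Theorems.ContactSourceDuhamel
open Summit.AtomisticToContinuum.HydrodynamicLimit.Theorems.ContactSourceDuhamel.TimeLocal
open Literature.MathematicalPhysics.KineticTheory (hsDiameter localGibbsLaw empiricalDensityField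
  empiricalMomentumField hardSphereKernel sphereMeasure)

noncomputable section

/-! ## §1 Free-flight geometry of an ordered pair: on-course pairs, hit time, predicted marks -/

/-- The torus geometry of the crux (`𝕋³`, minimal-image separation). -/
abbrev G3 : Geometry (Fin 3) T3 := Torus.geometry (Fin 3)

/-- The sphere diameter `ε_N = σ (N+1)^{-1/3}` of the crux. -/
abbrev diam (σ : ℝ) (N : ℕ) : ℝ := hsDiameter σ N

/-- The LOOK-BACK LENGTH `r_N = (N+1)^{-1/3}`: the inter-particle distance, strictly between the diameter
`ε_N = σ r_N` and the mean free path `≍ r_N/σ²` for small `σ` (no hand-picked constant: the dilute window of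
the card is `σ r_N ≪ r_N ≪ r_N/σ²`). -/
def lookBack (N : ℕ) : ℝ := ((N + 1 : ℕ) : ℝ) ^ (-(1 / 3 : ℝ))

/-- The FREE HIT TIME of a relative position `ξ` moving with relative velocity `g` towards the sphere of radius
`ε`: the least `u > 0` with `‖ξ + u g‖ = ε` (junk `sInf ∅ = 0` when the free ray misses the sphere). -/
def hitTime (ε : ℝ) (ξ g : V3) : ℝ := sInf {u : ℝ | 0 < u ∧ ‖ξ + u • g‖ = ε}

/-- ON COURSE within look-back length `r`: the pair is outside contact (`ε < ‖ξ‖`) and its free relative motion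
reaches contact after a relative displacement of length at most `r` (the approach cylinder of the card, seen from
the pair: `ξ ∈ {ε ω − u g : 0 < u ≤ r/|g|, g·ω < 0}`).  Symmetric under `(ξ, g) ↦ (−ξ, −g)`. -/
def OnCourse (ε r : ℝ) (ξ g : V3) : Prop :=
  ε < ‖ξ‖ ∧ ∃ u : ℝ, 0 < u ∧ ‖g‖ * u ≤ r ∧ ‖ξ + u • g‖ = ε

/-- The PREDICTED IMPACT VECTOR `ω̂* = ε⁻¹ (ξ + u* g)` (a unit vector from the partner to the particle when the
pair is on course; then `g · ω̂* < 0`). -/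
def hitDir (ε : ℝ) (ξ g : V3) : V3 := ε⁻¹ • (ξ + hitTime ε ξ g • g)

/-- Minimal-image relative position `x_i − x_j` of the ordered pair `(i, j)` of a configuration. -/
def relPos {N : ℕ} (w : Cfg N) (i j : Fin (N + 1)) : V3 := G3.sepVec (w i).1 (w j).1

/-- Relative velocity `v_i − v_j` of the ordered pair `(i, j)`. -/
def relVel {N : ℕ} (w : Cfg N) (i j : Fin (N + 1)) : V3 := (w i).2 - (w j).2

/-- MARK TESTS: functions of a contact's time `τ`, the position of the FIRST particle of the ordered pair, the
impact vector `ω̂ = (x_fst − x_snd)/ε`, and the pre-collisional velocities `(v_fst⁻, v_snd⁻)`. -/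
abbrev MarkTest : Type := ℝ → T3 → V3 → V3 → V3 → ℝ

/-- The PREDICTED MARK VALUE of a test for the ordered pair `(i, j)` of the configuration `w` seen at time `b`:
contact time `b + u*`, contact position `x_i + u* v_i`, impact vector `ω̂*`, current (= pre-collisional)
velocities. -/
def predMark {N : ℕ} (ε : ℝ) (Ψ : MarkTest) (b : ℝ) (w : Cfg N) (i j : Fin (N + 1)) : ℝ :=
  Ψ (b + hitTime ε (relPos w i j) (relVel w i j))
    (G3.translate (w i).1 (hitTime ε (relPos w i j) (relVel w i j) • (w i).2))
    (hitDir ε (relPos w i j) (relVel w i j)) (w i).2 (w j).2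

/-! ## §2 The bulk functional and the three event sums of the conjugacy identity -/

/-- THE BULK (APPROACH-CYLINDER) FUNCTIONAL of ONE configuration `w` seen at time `s`: the sum over the ordered
on-course pairs `(i, j)` (look-back `r_N`, diameter `ε_N`) of the special-flow weight `|g|/r_N` times the test at
the PREDICTED marks.  Positive-measure locus: under the homogeneous Gibbs law each particle has `≍ σ²` on-course
partners (cylinder volume `π ε² r` is `g`-independent, so at equilibrium on-course pairs factorise exactly up to
the involution-invariant `g₂`-shell distortion; TRIAGE r1-2). -/
def bulkPred (σ : ℝ) (N : ℕ) (Ψ : MarkTest) (s : ℝ) (w : Cfg N) : ℝ :=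
  ∑ i : Fin (N + 1), ∑ j : Fin (N + 1),
    if i ≠ j ∧ OnCourse (diam σ N) (lookBack N) (relPos w i j) (relVel w i j) then
      ‖relVel w i j‖ / lookBack N * predMark (diam σ N) Ψ s w i j
    else 0

/-- The start of the current free flight of particle `k` at time `τ` along the orbit of `z` (last collision time
of `k` in `(0, τ)`, else `0`; `FluidPDE.flightStart`). -/
def fs (σ : ℝ) (N : ℕ) (Φ : Flow σ N) (z : Cfg N) (k : Fin (N + 1)) (τ : ℝ) : ℝ :=
  flightStart G3 (diam σ N) (fun s => Φ.flow s z) 0 k τ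

/-- THE FULL CONTACT SUM on `(0, t]`: `Σ_{ordered collisions (τ, i, j)} Ψ(τ, x_i, ω̂, v_i⁻, v_j⁻)`, the
pre-collisional velocities read off the (right-continuous, post-collisional) configuration through the elastic
involution `collidePair` (`HardSphereCollisionRecord.ofConfig_preVel_eq_collidePair`).  Meaningful on `Φ.good`. -/
def contactSum (σ : ℝ) (N : ℕ) (Φ : Flow σ N) (Ψ : MarkTest) (t : ℝ) (z : Cfg N) : ℝ :=
  collisionPairSum G3 (diam σ N) (fun s => Φ.flow s z) (Set.Ioc 0 t)
    (fun τ i j =>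
      Ψ τ (Φ.flow τ z i).1 ((diam σ N)⁻¹ • relPos (Φ.flow τ z) i j)
        ((collidePair G3 i j (Φ.flow τ z)) i).2 ((collidePair G3 i j (Φ.flow τ z)) j).2)

/-- THE FRACTIONAL CONTACT SUM: each ordered collision `(τ, i, j)` weighted by the fraction
`min(1, (|g⁻|/r_N)(τ − max(fs_i, fs_j)))` of its look-back that was actually spent on course (cut by the later
of the two partners' previous collisions, or by time `0`). -/
def contactFrac (σ : ℝ) (N : ℕ) (Φ : Flow σ N) (Ψ : MarkTest) (t : ℝ) (z : Cfg N) : ℝ :=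
  collisionPairSum G3 (diam σ N) (fun s => Φ.flow s z) (Set.Ioc 0 t)
    (fun τ i j =>
      min 1 (‖relVel (collidePair G3 i j (Φ.flow τ z)) i j‖ / lookBack N *
          (τ - max (fs σ N Φ z i τ) (fs σ N Φ z j τ))) *
        Ψ τ (Φ.flow τ z i).1 ((diam σ N)⁻¹ • relPos (Φ.flow τ z) i j)
          ((collidePair G3 i j (Φ.flow τ z)) i).2 ((collidePair G3 i j (Φ.flow τ z)) j).2)

/-- An OPEN PASSAGE of the ordered pair `(i, j)` of the configuration `w` (the state just BEFORE time `b`), whose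
current free interval began at time `a`: if the pair is on course, the bulk weight `|g|/r_N` times the time
already spent on course, `(b − max(a, b + u* − r_N/|g|))₊`, times the test at the predicted marks; else `0`. -/
def passage (σ : ℝ) (N : ℕ) (Ψ : MarkTest) (b a : ℝ) (w : Cfg N) (i j : Fin (N + 1)) : ℝ :=
  if i ≠ j ∧ OnCourse (diam σ N) (lookBack N) (relPos w i j) (relVel w i j) then
    ‖relVel w i j‖ / lookBack N *
      max 0 (b - max a (b + hitTime (diam σ N) (relPos w i j) (relVel w i j) - lookBack N / ‖relVel w i j‖)) *
      predMark (diam σ N) Ψ b w i j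
  else 0

/-- THE FRUSTRATED PASSAGES on `(0, t]`: at each ordered collision `(τ, p, q)`, for every third particle `k`, the
open passages of the ordered pairs `(p, k)` and `(k, p)` in the PRE-collisional state `collidePair p q (Φ_τ z)`
(the record `(q, p)` accounts for the pairs through `q`, so each frustrated passage is counted once). -/
def frustrated (σ : ℝ) (N : ℕ) (Φ : Flow σ N) (Ψ : MarkTest) (t : ℝ) (z : Cfg N) : ℝ :=
  collisionPairSum G3 (diam σ N) (fun s => Φ.flow s z) (Set.Ioc 0 t)
    (fun τ p q => ∑ k : Fin (N + 1),
      if k ≠ p ∧ k ≠ q then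
        passage σ N Ψ τ (max (fs σ N Φ z p τ) (fs σ N Φ z k τ)) (collidePair G3 p q (Φ.flow τ z)) p k +
          passage σ N Ψ τ (max (fs σ N Φ z k τ) (fs σ N Φ z p τ)) (collidePair G3 p q (Φ.flow τ z)) k p
      else 0)

/-- THE TAIL at the horizon `t`: the open passages of all ordered pairs of `Φ_t z`. -/
def tail (σ : ℝ) (N : ℕ) (Φ : Flow σ N) (Ψ : MarkTest) (t : ℝ) (z : Cfg N) : ℝ :=
  ∑ i : Fin (N + 1), ∑ j : Fin (N + 1),
    passage σ N Ψ t (max (fs σ N Φ z i t) (fs σ N Φ z j t)) (Φ.flow t z) i j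

/-- **THE CONJUGACY IDENTITY at reduced density `σ`** (statement of STUB 1).  For every `N` with
`ε_N + r_N < 1/4` (minimal images evolve continuously along a passage), every hard-sphere flow, every GOOD initial
datum, every mark test `Ψ`, and every horizon `t ≥ 0` that is not a collision time of the orbit:
`∫₀ᵗ bulkPred Ψ (Φ_s z) ds = contactFrac Ψ + frustrated Ψ + tail Ψ` — exactly.  Proof sketch (pathwise,
deterministic): fix an ordered pair `(i, j)` and partition `[0, t]` at the collision times of either partner
(finitely many; binary collisions, free flight in between and incoming left limits are the fields of
`IsHardSphereTrajectory`, `Φ.isTrajectory`).  If the pair is on course at a time `s` of a free interval `(a, b)`,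
with hit time `u*`, then (α) `s + u* ≥ b` (else free flight would produce an `(i, j)` contact inside `(a, b)`),
(β) it stays on course on `[s, min(b, s + u*))` with CONSTANT predicted marks (contact time `s + u*`, contact
position, impact vector, velocities are free-flight invariants; `|ξ + u g|` decreases before closest approach, so
the minimal image is the free continuation, of norm `≤ ε_N + r_N < 1/4`), and (γ) it is NOT on course at the times
of `(a, b)` before `s + u* − r_N/|g|` (a hit within travel `r_N` from there, along the continuation or along
another lattice image, would again be an actual collision inside the free interval).  Hence on `(a, b)` the
on-course set is the single interval `[max(a, b' − r_N/|g|), b) ` with `b' = s + u* ≥ b` the predicted contact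
time, on which the bulk summand is constant and integrates to `(|g|/r_N)·length·Ψ(predicted marks)`: `b' = b` iff
the interval ends with the `(i, j)` collision itself — predicted marks = realised marks, weight = `contactFrac`'s
fraction (`a = max(fs_i, fs_j)` read at `b`); `b' > b` iff it ends with a third-body collision of `i` or `j`
(`frustrated`, read off the pre-collisional state at `b`, remaining hit time `b' − b`) or with `b = t` (`tail`). -/
def ConjugacyIdentity (σ : ℝ) : Prop :=
  ∀ (N : ℕ), diam σ N + lookBack N < 4⁻¹ →
    ∀ (Φ : Flow σ N) (z : Cfg N), z ∈ Φ.good →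
      ∀ (Ψ : MarkTest) (t : ℝ), 0 ≤ t → t ∉ collisionTimes G3 (diam σ N) (fun s => Φ.flow s z) →
        ∫ s in Icc 0 t, bulkPred σ N Ψ s (Φ.flow s z) =
          contactFrac σ N Φ Ψ t z + frustrated σ N Φ Ψ t z + tail σ N Φ Ψ t z

/-- THE INTERCEPTION BRACKET of a mark test on `(0, t]`: short-gap deficit minus frustrated passages minus
tail, `(contactSum − contactFrac) − frustrated − tail` — a signed sum over the `O(σ²)`-stratum of events with a
third body (or a window end) within one look-back.  By the conjugacy identity it is EXACTLY the difference
between the full contact sum and the bulk integral (`contactSum_eq_integral_bulkPred_add_bracket`). -/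
def bracket (σ : ℝ) (N : ℕ) (Φ : Flow σ N) (Ψ : MarkTest) (t : ℝ) (z : Cfg N) : ℝ :=
  contactSum σ N Φ Ψ t z - contactFrac σ N Φ Ψ t z - frustrated σ N Φ Ψ t z - tail σ N Φ Ψ t z

/-- Corollary form of the conjugacy identity: CONTACT SUM = BULK INTEGRAL + INTERCEPTION BRACKET (this is how
STUB 2 consumes STUB 1: what it must slave is `bracket`, an explicit event sum). -/
theorem contactSum_eq_integral_bulkPred_add_bracket {σ : ℝ} (h : ConjugacyIdentity σ) {N : ℕ}
    (hN : diam σ N + lookBack N < 4⁻¹) (Φ : Flow σ N) {z : Cfg N} (hz : z ∈ Φ.good) (Ψ : MarkTest)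
    {t : ℝ} (ht : 0 ≤ t) (hct : t ∉ collisionTimes G3 (diam σ N) (fun s => Φ.flow s z)) :
    contactSum σ N Φ Ψ t z = (∫ s in Icc 0 t, bulkPred σ N Ψ s (Φ.flow s z)) + bracket σ N Φ Ψ t z := by
  rw [bracket, h N hN Φ z hz Ψ t ht hct]
  ring

/-! ## §3 The cell entropic test and the three entropic production functionals (realised / bulk / chaotic)

Cell kernel families are the crux's admissible kernels at a finer exponent `κc ∈ (1/6, 1/3)` (cells of radius
`(N+1)^{-κc}`: inside every block `(N+1)^{-γ}`, `γ ≤ 1/15`, above the mean free path `(N+1)^{-1/3}/σ²` up to the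
fixed factor, thin enough for sub-cell texture to be viscously short-lived — TRIAGE r1-3 sharpen (b)).  The host's
parameters `h` (velocity mollifier), `δ` (floor height), `θf` (floor temperature) are quantified INSIDE the chaos
predicates with a FIXED relative allowance `c` (the reason: `∃ σ₀` is chosen before them). -/

/-- Cell kernel family at exponent `κc ∈ (1/6, 1/3)` with constant `Cc` (the crux's `AdmissibleKernel`). -/
def CellKernel (κc Cc : ℝ) (φc : ℕ → T3 → ℝ) : Prop :=
  1 / 6 < κc ∧ κc < 1 / 3 ∧ AdmissibleKernel κc Cc φc

/-- The Gaussian velocity mollifier `G_h = M_{1, 0, h²}`. -/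
def gaussK (h : ℝ) (v : V3) : ℝ := localMaxwellian 1 (h ^ 2) (0 : V3) v

/-- The cell particle count density at `x`: `Σ_i φc_N(x_i − x)` (`≈ (N+1) ×` local number density). -/
def cellCount (N : ℕ) (φc : ℕ → T3 → ℝ) (w : Cfg N) (x : T3) : ℝ :=
  ∑ i : Fin (N + 1), φc N ((w i).1 - x)

/-- The MOLLIFIED CELL VELOCITY LAW at `x` (kernel density estimate, a probability density in `v` on a non-empty
cell; junk `·/0 = 0` on an empty cell, repaired by the floor). -/
def cellKde (N : ℕ) (φc : ℕ → T3 → ℝ) (h : ℝ) (w : Cfg N) (x : T3) (v : V3) : ℝ :=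
  (∑ i : Fin (N + 1), φc N ((w i).1 - x) * gaussK h (v - (w i).2)) / cellCount N φc w x

/-- The FLOORED cell law `F ∨ δ M_{1,0,θf}` (positive everywhere, so its logarithm is honest). -/
def cellKdeFloor (N : ℕ) (φc : ℕ → T3 → ℝ) (h δ θf : ℝ) (w : Cfg N) (x : T3) (v : V3) : ℝ :=
  max (cellKde N φc h w x v) (δ * localMaxwellian 1 θf (0 : V3) v)

/-- `Λ = log (F ∨ δ M)`, the cell's log-density. -/
def logKde (N : ℕ) (φc : ℕ → T3 → ℝ) (h δ θf : ℝ) (w : Cfg N) (x : T3) (v : V3) : ℝ :=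
  Real.log (cellKdeFloor N φc h δ θf w x v)

/-- THE CELL ENTROPIC TEST `Λ̃ = G_h ∗ Λ` (the mollified log-density: the exact first variation of the cell
entropy `∫ F log F` under moving one kde bump, whence the host's telescoping; canonical — no chosen test that
could degenerate at the goal, TRIAGE r1-3 Panel A). -/
def entTest (N : ℕ) (φc : ℕ → T3 → ℝ) (h δ θf : ℝ) (w : Cfg N) (x : T3) (v : V3) : ℝ :=
  ∫ u, gaussK h (v - u) * logKde N φc h δ θf w x u

/-- THE ENTROPIC INCREMENT (pre minus post) of the FIRST particle: `Λ̃(v) − Λ̃(v′)`, `v′` the outgoing velocity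
of the elastic law with impact vector `n` (`reflectVel`, scale-free in `n`).  Summed over both orders of a pair it
is the full pair decrement `−ΔΛ̃`, odd under the collision involution. -/
def entInc (N : ℕ) (φc : ℕ → T3 → ℝ) (h δ θf : ℝ) (w : Cfg N) (x : T3) (n v vs : V3) : ℝ :=
  entTest N φc h δ θf w x v - entTest N φc h δ θf w x (reflectVel n (v, vs)).1

/-- REALISED entropic contact production on `(0, t]` attributed to the cell at `x`: the full contact sum of the
test `φc_N(x_fst − x) · (Λ̃_{τ,x}(v_fst⁻) − Λ̃_{τ,x}(v_fst⁺))`, `Λ̃_{τ,x}` built from the configuration `Φ_τ z`. -/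
def realisedEntAt (σ : ℝ) (N : ℕ) (Φ : Flow σ N) (φc : ℕ → T3 → ℝ) (h δ θf t : ℝ) (z : Cfg N)
    (x : T3) : ℝ :=
  collisionPairSum G3 (diam σ N) (fun s => Φ.flow s z) (Set.Ioc 0 t)
    (fun τ i j =>
      φc N ((Φ.flow τ z i).1 - x) *
        entInc N φc h δ θf (Φ.flow τ z) x (relPos (Φ.flow τ z) i j)
          ((collidePair G3 i j (Φ.flow τ z)) i).2 ((collidePair G3 i j (Φ.flow τ z)) j).2)

/-- REALISED entropic contact production on `(0, t]`, integrated over the cells. -/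
def realisedEnt (σ : ℝ) (N : ℕ) (Φ : Flow σ N) (φc : ℕ → T3 → ℝ) (h δ θf t : ℝ) (z : Cfg N) : ℝ :=
  ∫ x, realisedEntAt σ N Φ φc h δ θf t z x

/-- BULK (one-time-slice) entropic production of the configuration `w` attributed to the cell at `x`: the sum
over ordered on-course pairs of `|g|/r_N · φc_N(x̂_i − x) · (Λ̃_x(v_i) − Λ̃_x(v_i′))`, `x̂_i` the predicted
contact position, `v_i′` the predicted outgoing velocity (impact vector `ω̂*`), `Λ̃_x` built from `w` itself —
every ingredient is a function of the ONE configuration `w`. -/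
def bulkEntAt (σ : ℝ) (N : ℕ) (φc : ℕ → T3 → ℝ) (h δ θf : ℝ) (w : Cfg N) (x : T3) : ℝ :=
  ∑ i : Fin (N + 1), ∑ j : Fin (N + 1),
    if i ≠ j ∧ OnCourse (diam σ N) (lookBack N) (relPos w i j) (relVel w i j) then
      ‖relVel w i j‖ / lookBack N *
        (φc N (G3.translate (w i).1 (hitTime (diam σ N) (relPos w i j) (relVel w i j) • (w i).2) - x) *
          entInc N φc h δ θf w x (hitDir (diam σ N) (relPos w i j) (relVel w i j)) (w i).2 (w j).2)
    else 0

/-- BULK entropic production on `[0, t]`: `∫₀ᵗ ∫ₓ bulkEntAt (Φ_s z) x dx ds`. -/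
def bulkEnt (σ : ℝ) (N : ℕ) (Φ : Flow σ N) (φc : ℕ → T3 → ℝ) (h δ θf t : ℝ) (z : Cfg N) : ℝ :=
  ∫ s in Icc 0 t, ∫ x, bulkEntAt σ N φc h δ θf (Φ.flow s z) x

/-- CHAOTIC entropic production of the configuration `w` attributed to the cell at `x`: the value of the same
production on the FLUX-WEIGHTED PRODUCT of the CELL-LOCAL empirical law — `ε_N² Σ_{i ≠ k} φc(x_i − x) φc(x_k − x)
∫_{S²} ((v_k − v_i)·ω)₊ (Λ̃_x(v_i) − Λ̃_x(v_i′(ω))) dσ(ω)` (ordered-collision rate of particle `i` with partners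
drawn independently from the local law with the hard-sphere flux; the Enskog factor `Y = 1 + O(σ³)` is part of the
relative allowance).  Molecular chaos in Boltzmann–Enskog form; `E_χ[−ΔΛ] ≈ 2𝒟(F)/Z ≥ 0` up to the kde
commutator, so this is the (coercive, second-order) dissipation the host consumes. -/
def chaosEntAt (σ : ℝ) (N : ℕ) (φc : ℕ → T3 → ℝ) (h δ θf : ℝ) (w : Cfg N) (x : T3) : ℝ :=
  diam σ N ^ 2 * ∑ i : Fin (N + 1), ∑ k : Fin (N + 1),
    if i ≠ k then
      φc N ((w i).1 - x) * φc N ((w k).1 - x) *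
        ∫ ω : Metric.sphere (0 : V3) 1,
          hardSphereKernel ((w k).2, (w i).2) ω * entInc N φc h δ θf w x (ω : V3) (w i).2 (w k).2 ∂sphereMeasure
    else 0

/-- CHAOTIC entropic production on `[0, t]`. -/
def chaosEnt (σ : ℝ) (N : ℕ) (Φ : Flow σ N) (φc : ℕ → T3 → ℝ) (h δ θf t : ℝ) (z : Cfg N) : ℝ :=
  ∫ s in Icc 0 t, ∫ x, chaosEntAt σ N φc h δ θf (Φ.flow s z) x

/-- The SIZE of the chaotic entropic production on `[0, t]` (cell-wise absolute values): the currency of every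
relative allowance of the line (second order in the non-equilibrium amplitude; TRIAGE: absolute forms are inert). -/
def absChaosEnt (σ : ℝ) (N : ℕ) (Φ : Flow σ N) (φc : ℕ → T3 → ℝ) (h δ θf t : ℝ) (z : Cfg N) : ℝ :=
  ∫ s in Icc 0 t, ∫ x, |chaosEntAt σ N φc h δ θf (Φ.flow s z) x|

/-! ## §4 The per-horizon predicates of the line -/

/-- CONTACT ENTROPIC CHAOS, RELATIVE, on `[0, t]` with allowance `c` (the interface consumed by the host): for
every cell kernel family, all host parameters `h, δ, θf > 0` and every `η > 0`,
`P(|realisedEnt − chaosEnt| > c · absChaosEnt + η (N+1)^{4/3}) → 0`.  (`(N+1)^{4/3} = ` particles × collision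
rate scale: the slack is `o(1)` per nominal contact; the relative part absorbs rings, the Enskog factor and every
fixed `O(σ²)`/`O(σ³)` stratum.) -/
def ContactEntropicChaosOn (σ : ℝ) (a₀ θ₀ : T3 → ℝ) (u₀ : T3 → V3) (Φ : Flows σ) (c t : ℝ) : Prop :=
  ∀ (κc Cc : ℝ) (φc : ℕ → T3 → ℝ), CellKernel κc Cc φc → ∀ (h δ θf : ℝ), 0 < h → 0 < δ → 0 < θf →
    ∀ η : ℝ, 0 < η →
      Tendsto (fun N : ℕ => localGibbsLaw σ a₀ u₀ θ₀ N (Φ N)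
        {z | c * absChaosEnt σ N (Φ N) φc h δ θf t z + η * ((N + 1 : ℕ) : ℝ) ^ ((4 : ℝ) / 3) <
          |realisedEnt σ N (Φ N) φc h δ θf t z - chaosEnt σ N (Φ N) φc h δ θf t z|}) atTop (𝓝 0)

/-- LOOK-BACK STRATUM SLAVED on `[0, t]` with allowance `c` (statement of STUB 2): the realised contact entropic
production and the BULK one-slice production differ by at most `c · absChaosEnt + o_P((N+1)^{4/3})`.  By the
conjugacy identity the difference is EXACTLY the interception bracket (`contactSum − contactFrac − frustrated −
tail` for the entropic mark test) plus the shift of the test's time stamp within one look-back — both carried by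
the `O(σ²)`-stratum of contacts with a third body within `r_N`, both first order with an equilibrium-vanishing
coefficient (stationarity + involution symmetry), hence second order. -/
def LookBackSlavedOn (σ : ℝ) (a₀ θ₀ : T3 → ℝ) (u₀ : T3 → V3) (Φ : Flows σ) (c t : ℝ) : Prop :=
  ∀ (κc Cc : ℝ) (φc : ℕ → T3 → ℝ), CellKernel κc Cc φc → ∀ (h δ θf : ℝ), 0 < h → 0 < δ → 0 < θf →
    ∀ η : ℝ, 0 < η →
      Tendsto (fun N : ℕ => localGibbsLaw σ a₀ u₀ θ₀ N (Φ N)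
        {z | c * absChaosEnt σ N (Φ N) φc h δ θf t z + η * ((N + 1 : ℕ) : ℝ) ^ ((4 : ℝ) / 3) <
          |realisedEnt σ N (Φ N) φc h δ θf t z - bulkEnt σ N (Φ N) φc h δ θf t z|}) atTop (𝓝 0)

/-- APPROACH-CYLINDER ENTROPIC CHAOS, RELATIVE, on `[0, t]` with allowance `c` (statement of STUB 3, THE
RESIDUE): the bulk one-slice production and its chaotic (flux × cell-local product) value differ by at most
`c · absChaosEnt + o_P((N+1)^{4/3})`.  A statement about snapshots `Φ_s z` only. -/
def CylinderEntropicChaosOn (σ : ℝ) (a₀ θ₀ : T3 → ℝ) (u₀ : T3 → V3) (Φ : Flows σ) (c t : ℝ) : Prop :=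
  ∀ (κc Cc : ℝ) (φc : ℕ → T3 → ℝ), CellKernel κc Cc φc → ∀ (h δ θf : ℝ), 0 < h → 0 < δ → 0 < θf →
    ∀ η : ℝ, 0 < η →
      Tendsto (fun N : ℕ => localGibbsLaw σ a₀ u₀ θ₀ N (Φ N)
        {z | c * absChaosEnt σ N (Φ N) φc h δ θf t z + η * ((N + 1 : ℕ) : ℝ) ^ ((4 : ℝ) / 3) <
          |bulkEnt σ N (Φ N) φc h δ θf t z - chaosEnt σ N (Φ N) φc h δ θf t z|}) atTop (𝓝 0)

/-- The GERMANO (sub-block Reynolds) density at `(s, x)`: the block-kernel average over cell centres `y` of the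
cell mass density times the squared deviation of the cell velocity `ū_c(y)` from the block velocity `ū_B(x)`
(`ū = m̄/ρ̄` with the crux's junk `0⁻¹ = 0` on empty cells/blocks).  Every Germano remainder of the block
stress `D_B` AND of the block heat flux `q_B` carries a factor of `ū_c − ū_B` (TRIAGE r1-3 B(iii)). -/
def reynoldsSq (N : ℕ) (φ φc : ℕ → T3 → ℝ) (w : Cfg N) (x : T3) : ℝ :=
  ∫ y, φ N (y - x) * empiricalDensityField w (fun y' => φc N (y' - y)) *
    ‖(empiricalDensityField w (fun y' => φc N (y' - y)))⁻¹ • empiricalMomentumField w (fun y' => φc N (y' - y)) -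
        (empiricalDensityField w (fun y' => φ N (y' - x)))⁻¹ • empiricalMomentumField w (fun y' => φ N (y' - x))‖ ^ 2

/-- SUB-BLOCK REYNOLDS REMAINDER VANISHES on `[0, t]` (statement of STUB 5; the declared hydro-class remainder,
`SubBlockReynoldsVanish` of card `sustained-anisotropy-superexp`): for every admissible block kernel family
(`γ ≤ 1/15`), every cell kernel family and every `δ > 0`, `P(∫₀ᵗ ∫ₓ reynoldsSq > δ) → 0`.  Not implied by the
crux's conclusion (traceless cell stresses and the Reynolds tensor can cancel, TRIAGE r1-2 (b)). -/
def SubBlockReynoldsOn (σ : ℝ) (a₀ θ₀ : T3 → ℝ) (u₀ : T3 → V3) (Φ : Flows σ) (t : ℝ) : Prop :=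
  ∀ (γ C : ℝ) (φ : ℕ → T3 → ℝ), 0 < γ → γ ≤ 1 / 15 → AdmissibleKernel γ C φ →
    ∀ (κc Cc : ℝ) (φc : ℕ → T3 → ℝ), CellKernel κc Cc φc → ∀ δ : ℝ, 0 < δ →
      Tendsto (fun N : ℕ => localGibbsLaw σ a₀ u₀ θ₀ N (Φ N)
        {z | δ < ∫ s in Icc 0 t, ∫ x, reynoldsSq N φ φc ((Φ N).flow s z) x}) atTop (𝓝 0)

/-! ## §5 Registered stubs (`Holds.stub_*`, bodies `sorry`) -/

namespace Holds

/-- STUB 1 (CONJUGACY IDENTITY — provable-now kinematics; size M/L: collision-time partition per pair,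
`flightStart` API, `IsHardSphereTrajectory.free/binary`, torus minimal images for `ε_N + r_N < 1/4`).  Why it might
fail: only through a boundary convention (the horizon `t` is assumed not to be a collision time; flight starts are
read over the OPEN interval `(0, τ)`; simultaneous/grazing collisions are absent on `Φ.good`) — a misstatement of
that kind is repaired by re-cutting the three event sums, not by abandoning the identity (CIP 1994 App. 4.A,
`dz = dσ du`; GST 2013 Prop. 12.3.1: pre-collisional pairs separate under backward free flow). -/
theorem stub_conjugacy : ∀ σ : ℝ, 0 < σ → σ < 2⁻¹ → ConjugacyIdentity σ := by
  sorry

/-- STUB 2 (LOOK-BACK STRATUM SLAVED — size L; OPEN, thin-stratum three-body chaos).  For all nice profiles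
there is `σ₀ > 0` such that for `0 < σ < σ₀`, given the conjugacy identity at `σ`, for every flow family (H1
offered) and every horizon `t > 0` with H2 on `[0, t]`, some allowance `c ∈ [0, 1/2)` slaves the look-back stratum:
`LookBackSlavedOn c t`.  Content: (a) the interception bracket of the entropic mark test — contacts preceded within
`r_N/|g|` by a collision of a partner, passages frustrated by a third body, passages open at `t` — is a sum over an
`O(σ²)`-fraction of the contacts (EXCESS short-gap counts over the local-density prediction are super-exponentially
rare under the invariant Gibbs law at speed `N n_N` and transfer by `KipnisLandim1999_A1_8_2_holds` + FrostBudget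
9237 + GibbsInvariance 9239 — the card's item 5; raw fractions are only exponentially concentrated, never price
them); (b) its entropic value is first order in the cell's non-equilibrium amplitude with a coefficient that
VANISHES at equilibrium for every one-particle observable (`E[Σ_all contacts Δg] = 0` by stationarity and
`E[bulk on-course Δg] = 0` by involution invariance of the equilibrium cylinder law), hence second order — bounded
by `c(σ) · absChaosEnt` with `c(σ) = O(σ²)`; (c) the test's time stamp moves by at most one look-back `r_N/|g|`
between bulk selection and contact (collisional change of the cell law over a look-back: relative `O(σ²) ×`
amplitude; streaming change: coefficient `r_N → 0`; slow pairs carry vanishing flux weight, H2 gives uniform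
integrability).  Why it might fail: (b) is a linear-response-type statement about the biased sub-class of
short-gap contacts along the NON-equilibrium law — the same absence-of-proof class as the residue, on a thin
stratum; dense post-implosion transients make the stratum thick (`∀ t > 0` exposure, Disproof F2/§6). -/
theorem stub_lookBack :
    ∀ (a₀ θ₀ : T3 → ℝ) (u₀ : T3 → V3), NiceProfiles a₀ θ₀ u₀ →
      ∃ σ₀ : ℝ, 0 < σ₀ ∧ ∀ σ : ℝ, 0 < σ → σ < σ₀ → ConjugacyIdentity σ →
        ∀ Φ : Flows σ, DiffuseAt σ a₀ θ₀ u₀ Φ →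
          ∀ t : ℝ, 0 < t → TailsOn σ a₀ θ₀ u₀ Φ t →
            ∃ c : ℝ, 0 ≤ c ∧ c < 2⁻¹ ∧ LookBackSlavedOn σ a₀ θ₀ u₀ Φ c t := by
  sorry

/-- STUB 3 (APPROACH-CYLINDER ENTROPIC CHAOS — THE RESIDUE; size XL; OPEN, Stosszahlansatz class on a
positive-measure one-slice locus).  For all nice profiles there is `σ₀ > 0` such that for `0 < σ < σ₀`, every flow
family (H1 offered) and every horizon `t > 0` with H2 on `[0, t]`, some allowance `c ∈ [0, 1/2)` gives
`CylinderEntropicChaosOn c t`: along the local-Gibbs flow, the entropic production of the ON-COURSE pairs of the snapshots `Φ_s z` equals its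
value on the flux-weighted PRODUCT of the cell-local empirical laws, up to `c · absChaosEnt + o_P((N+1)^{4/3})`.
Why plausible: (i) exact at equilibrium for every production test (cylinder volume `π ε² r` is `g`-independent;
the `g₂`-shell distortion of the first `ε` of the cylinder, relative `O(σ⁴)`, is involution-invariant and
invisible to production tests); (ii) off equilibrium, ring/recollision correlations of approaching pairs are first
order in the cell's non-Maxwellian amplitude `A` with coefficient `O(σ³)` (Disproof F4: measured `−4.5 … −21 %` for
`φ = 0.01 … 0.3`), and the entropic test `Λ̃ − log M` is itself `O(A)`, so the defect is `O(σ³) A²` against a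
chaotic entropic production `≍ A²` that is COERCIVE (linearised: `hardSphereLinearizedOp_spectralGap_holds`;
nonlinear: EEP) — the one test for which "relative to its own chaotic production" is not defeated by a vanishing
chaotic value (for a generic test `g` the chaotic production `𝓔(φ₁, g)` can vanish while the ring form `𝓡(φ₁, g)`
does not: same-test-relative chaos is false for generic `g`, true-in-kind for `g = φ₁`); (iii) positive measure:
refuters can price it statically per slice under explicit tilts and MD sees `σ⁻³×` more on-course pairs than
contacts (card falsifiers (1)–(2): approach cylinders must pass, recession cylinders must fail — a built-in
control).  Why it might fail: it IS Bogoliubov's boundary condition as an in-probability snapshot statement at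
fixed `σ` along the non-equilibrium law for all `t > 0` (`BoltzmannHypothesisBarrierNarrow` (b): absence of proof);
enemies: `O(1)`-density transient clusters (rings not subordinate), sub-CELL velocity texture straddled by a cell
(the cell product law is then a mixture — the exceptional space-time set of TRIAGE r1-1/r1-3 must have vanishing
`absChaosEnt`-weight), and the uniformity of `c` in the host parameters `(h, δ, θf)` (ring form vs Dirichlet form
bounded in the same weighted `L²(M)` norm — the bet). -/
theorem stub_cylinderChaos :
    ∀ (a₀ θ₀ : T3 → ℝ) (u₀ : T3 → V3), NiceProfiles a₀ θ₀ u₀ →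
      ∃ σ₀ : ℝ, 0 < σ₀ ∧ ∀ σ : ℝ, 0 < σ → σ < σ₀ →
        ∀ Φ : Flows σ, DiffuseAt σ a₀ θ₀ u₀ Φ →
          ∀ t : ℝ, 0 < t → TailsOn σ a₀ θ₀ u₀ Φ t →
            ∃ c : ℝ, 0 ≤ c ∧ c < 2⁻¹ ∧ CylinderEntropicChaosOn σ a₀ θ₀ u₀ Φ c t := by
  sorry

/-- STUB 4 (ENTROPIC CLOSURE — THE HOST; size XL in work but theorem-backed at every step; the architecture of
card `block-h-dissipation-closure` as re-typed by TRIAGE r1-3 Panel A/C).  For nice profiles, `0 < σ < 1/2`, every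
flow family and every horizon `t > 0` with H2 on `[0, t]`: relative contact entropic chaos with ANY allowance
`c ∈ [0, 1)` and the sub-block Reynolds remainder give the crux's conclusion on `[0, t]`.  Route: (1) EXACT
TELESCOPING of the cell entropy `S_N(s) = ∫ₓ cellCount_x · ∫ᵥ Φ_δ(F_{s,x}(v)) dv dx`, `Φ_δ` the CONVEX primitive of
`F ↦ log (F ∨ δ M_{1,0,θf})` (so that the exact first variation of `S_N` under moving one kde bump of particle `i`
from `v` to `v′` is `φc(x_i − x)(Λ̃_x(v′) − Λ̃_x(v))`, i.e. minus the summand of `realisedEntAt`), along a good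
orbit — free-flight transport `|dS_N/ds| = O_P(N^{κc} log N · Σ(|v| + |v|³)) = o_P(N^{4/3})` under H2, and at each
collision the jump `= −(realised entropic increment) + R₂` with `R₂ ≥ 0` by convexity (second variation of
`∫ F log F` under moving two kde bumps; `R₂/(N^{4/3} t) ≍ 1/(m_cell h³ δ) → 0`, TRIAGE r1-3 B(iv)); `|S_N| ≤
C N (log N + log(1/δ) + 1/θf)`; hence `realisedEnt ≤ o_P((N+1)^{4/3})` (all deterministic/finite-sum, provable
now); (2) `ContactEntropicChaosOn c` then gives `chaosEnt − c · absChaosEnt ≤ o_P(N^{4/3})`, and `chaosEntAt ≥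
−(kde commutator) = −o(·)` cell-wise (its main term is `2𝒟(F_δ)/Z ≥ 0` for the flux-weighted product,
`entropyProduction_nonneg`), so `∫₀ᵗ Σ_cells rate × 𝒟(F_{s,x}) = o_P(N^{4/3})` for every `c < 1`; (3) the
entropy–entropy-production inequality for the hard-sphere kernel (Rezakhanlou–Villani, LNM 1916, Thm 4 p. 25–26
with Comment 4: constants explicit and POLYNOMIAL in the Sobolev/moment/lower bounds, which the mollifier `h`, the
floor `δ M_{θf}` and H2 supply — to be imported as a `[cite]` Literature fact with the exponents extracted, the
card's falsifier (1)) turns small dissipation into small relative entropy to the local Maxwellian at FIXED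
`(h, δ, θf)`, then `N → ∞` followed by `h, δ → 0` (the chaos hypothesis is available for ALL `h, δ, θf`, which is
why they are quantified inside it); (4) Csiszár–Kullback–Pinsker + uniform integrability from H2: cell traceless
stress and heat flux `→ 0` in `L²([0,t] × 𝕋³)`-probability (mollification adds `h²𝟙` isotropically and leaves the
third central moment unchanged); (5) Germano (law of total covariance, finite sums): block `D_B, q_B` = cell
averages + remainders each carrying a factor `ū_c − ū_B`, killed by `SubBlockReynoldsOn` + Cauchy–Schwarz + UI;
(6) `ConclOn` is the crux's event by the landed dictionary `Reduction.cruxIntegrand_eq`.  Why it might fail: a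
bookkeeping interface only — the one quantitative risk is the EEP constant's dependence on `(h, δ)` versus the
`N`-powers available (no rate is coupled: the shock-straddling share `N^{-γ}` is compatible with any polynomial
EEP loss, TRIAGE r1-3 B(ii)); if the extracted exponents were not polynomial the double limit in (3) needs the
`h_N, δ_N → 0` schedule of the block-h card instead. -/
theorem stub_entropicClosure :
    ∀ (a₀ θ₀ : T3 → ℝ) (u₀ : T3 → V3), NiceProfiles a₀ θ₀ u₀ →
      ∀ σ : ℝ, 0 < σ → σ < 2⁻¹ → ∀ Φ : Flows σ,
        ∀ t : ℝ, 0 < t → TailsOn σ a₀ θ₀ u₀ Φ t →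
          ∀ c : ℝ, 0 ≤ c → c < 1 → ContactEntropicChaosOn σ a₀ θ₀ u₀ Φ c t →
            SubBlockReynoldsOn σ a₀ θ₀ u₀ Φ t → ConclOn σ a₀ θ₀ u₀ Φ t := by
  sorry

/-- STUB 5 (SUB-BLOCK REYNOLDS REMAINDER — size L; OPEN, hydro-class).  For all nice profiles there is `σ₀ > 0`
such that for `0 < σ < σ₀`, every flow family (H1 offered) and every `t > 0` with H2 on `[0, t]`: the Germano
remainder between cells `(N+1)^{-κc}`, `κc ∈ (1/6, 1/3)`, and blocks `(N+1)^{-γ}`, `γ ≤ 1/15`, vanishes in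
`L¹([0,t] × 𝕋³)`-probability (`SubBlockReynoldsOn t`).  Why plausible: pre-shock it is `MesoQuiescence`-class
(stmt-9198) — the cell-mean velocity field tracks the smooth Euler field, thermal cell-mean noise is
`1/m_cell → 0`; post-shock a straddling slab contributes `(t − t_s)[u]² · (N+1)^{-γ} → 0` and a cascade from an
`O(1)` integral scale leaves only the Kolmogorov share `(N+1)^{-2γ/3} → 0` below the block scale (Disproof §6).
Why it might fail: sustained sub-block Kelvin–Helmholtz / Richtmyer–Meshkov Reynolds stress in the inviscid band
`N^{-1/6} ≪ ℓ ≪ N^{-γ}` after shock interactions — the crux's own `∀ t > 0` exposure (`PreShock` = C′ of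
`Negative/PreShockSuffices.lean` is all `closes` consumes, Disproof F1). -/
theorem stub_reynolds :
    ∀ (a₀ θ₀ : T3 → ℝ) (u₀ : T3 → V3), NiceProfiles a₀ θ₀ u₀ →
      ∃ σ₀ : ℝ, 0 < σ₀ ∧ ∀ σ : ℝ, 0 < σ → σ < σ₀ →
        ∀ Φ : Flows σ, DiffuseAt σ a₀ θ₀ u₀ Φ →
          ∀ t : ℝ, 0 < t → TailsOn σ a₀ θ₀ u₀ Φ t → SubBlockReynoldsOn σ a₀ θ₀ u₀ Φ t := by
  sorry

end Holds

/-! ## §6 Stub statements by name (D-0027 §3.3: the hypotheses of `_of` are the open stubs) -/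

/-- Statement of registered stub 1 (`Holds.stub_conjugacy`), by name. -/
def stub_conjugacy : Prop := type_of% Holds.stub_conjugacy
/-- Statement of registered stub 2 (`Holds.stub_lookBack`), by name. -/
def stub_lookBack : Prop := type_of% Holds.stub_lookBack
/-- Statement of registered stub 3 (`Holds.stub_cylinderChaos`), by name. -/
def stub_cylinderChaos : Prop := type_of% Holds.stub_cylinderChaos
/-- Statement of registered stub 4 (`Holds.stub_entropicClosure`), by name. -/
def stub_entropicClosure : Prop := type_of% Holds.stub_entropicClosure
/-- Statement of registered stub 5 (`Holds.stub_reynolds`), by name. -/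
def stub_reynolds : Prop := type_of% Holds.stub_reynolds

/-! ## §7 Composition (sorry-free): look-back + cylinder ⟹ contact chaos; the five stubs ⟹ the crux BY NAME -/

/-- PROBABILISTIC CORE (triangle inequality + union bound): the look-back stratum with allowance `cI` and
approach-cylinder chaos with allowance `cB` give contact entropic chaos with allowance `cI + cB`. -/
theorem contactEntropicChaosOn_of_lookBack_of_cylinder {σ : ℝ} {a₀ θ₀ : T3 → ℝ} {u₀ : T3 → V3}
    {Φ : Flows σ} {cI cB t : ℝ}
    (hI : LookBackSlavedOn σ a₀ θ₀ u₀ Φ cI t) (hB : CylinderEntropicChaosOn σ a₀ θ₀ u₀ Φ cB t) :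
    ContactEntropicChaosOn σ a₀ θ₀ u₀ Φ (cI + cB) t := by
  intro κc Cc φc hK h δ θf hh hδ hθf η hη
  have hη2 : 0 < η / 2 := half_pos hη
  have h1 := hI κc Cc φc hK h δ θf hh hδ hθf (η / 2) hη2
  have h2 := hB κc Cc φc hK h δ θf hh hδ hθf (η / 2) hη2
  -- the three events
  let E : (N : ℕ) → Set (Cfg N) := fun N =>
    {z | (cI + cB) * absChaosEnt σ N (Φ N) φc h δ θf t z + η * ((N + 1 : ℕ) : ℝ) ^ ((4 : ℝ) / 3) <
      |realisedEnt σ N (Φ N) φc h δ θf t z - chaosEnt σ N (Φ N) φc h δ θf t z|}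
  let E1 : (N : ℕ) → Set (Cfg N) := fun N =>
    {z | cI * absChaosEnt σ N (Φ N) φc h δ θf t z + η / 2 * ((N + 1 : ℕ) : ℝ) ^ ((4 : ℝ) / 3) <
      |realisedEnt σ N (Φ N) φc h δ θf t z - bulkEnt σ N (Φ N) φc h δ θf t z|}
  let E2 : (N : ℕ) → Set (Cfg N) := fun N =>
    {z | cB * absChaosEnt σ N (Φ N) φc h δ θf t z + η / 2 * ((N + 1 : ℕ) : ℝ) ^ ((4 : ℝ) / 3) <
      |bulkEnt σ N (Φ N) φc h δ θf t z - chaosEnt σ N (Φ N) φc h δ θf t z|}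
  -- deterministic inclusion `E ⊆ E1 ∪ E2`
  have hincl : ∀ N : ℕ, E N ⊆ E1 N ∪ E2 N := by
    intro N z hz
    by_contra hnot
    simp only [Set.mem_union, Set.mem_setOf_eq, not_or, not_lt, E1, E2] at hnot
    obtain ⟨hz1, hz2⟩ := hnot
    simp only [Set.mem_setOf_eq, E] at hz
    have htri : |realisedEnt σ N (Φ N) φc h δ θf t z - chaosEnt σ N (Φ N) φc h δ θf t z| ≤
        |realisedEnt σ N (Φ N) φc h δ θf t z - bulkEnt σ N (Φ N) φc h δ θf t z| +
          |bulkEnt σ N (Φ N) φc h δ θf t z - chaosEnt σ N (Φ N) φc h δ θf t z| := by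
      have := abs_sub_le (realisedEnt σ N (Φ N) φc h δ θf t z) (bulkEnt σ N (Φ N) φc h δ θf t z)
        (chaosEnt σ N (Φ N) φc h δ θf t z)
      exact this
    have hsum : |realisedEnt σ N (Φ N) φc h δ θf t z - bulkEnt σ N (Φ N) φc h δ θf t z| +
        |bulkEnt σ N (Φ N) φc h δ θf t z - chaosEnt σ N (Φ N) φc h δ θf t z| ≤
        (cI + cB) * absChaosEnt σ N (Φ N) φc h δ θf t z + η * ((N + 1 : ℕ) : ℝ) ^ ((4 : ℝ) / 3) := by
      have hadd := add_le_add hz1 hz2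
      have hrw : cI * absChaosEnt σ N (Φ N) φc h δ θf t z + η / 2 * ((N + 1 : ℕ) : ℝ) ^ ((4 : ℝ) / 3) +
          (cB * absChaosEnt σ N (Φ N) φc h δ θf t z + η / 2 * ((N + 1 : ℕ) : ℝ) ^ ((4 : ℝ) / 3)) =
          (cI + cB) * absChaosEnt σ N (Φ N) φc h δ θf t z + η * ((N + 1 : ℕ) : ℝ) ^ ((4 : ℝ) / 3) := by
        ring
      linarith [hadd, hrw]
    linarith [htri, hsum, hz]
  -- measure bound and limit
  have hle : ∀ N : ℕ, localGibbsLaw σ a₀ u₀ θ₀ N (Φ N) (E N) ≤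
      localGibbsLaw σ a₀ u₀ θ₀ N (Φ N) (E1 N) + localGibbsLaw σ a₀ u₀ θ₀ N (Φ N) (E2 N) := fun N =>
    (measure_mono (hincl N)).trans (measure_union_le _ _)
  have hsum0 : Tendsto (fun N : ℕ => localGibbsLaw σ a₀ u₀ θ₀ N (Φ N) (E1 N) +
      localGibbsLaw σ a₀ u₀ θ₀ N (Φ N) (E2 N)) atTop (𝓝 0) := by
    have := h1.add h2
    rw [add_zero] at this
    exact this
  exact tendsto_of_tendsto_of_tendsto_of_le_of_le' tendsto_const_nhds hsum0
    (Eventually.of_forall fun N => bot_le) (Eventually.of_forall hle)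

/-- **THE SKELETON THEOREM.** The five stubs give the crux `CollisionIsometryCLT.AdaptedWeightCLT` (rev-12,
time-local form) BY NAME: `adaptedWeightCLT_iff` (`Iff.rfl`), `σ₀ := min (min σ₂ σ₃) (min σ₅ 2⁻¹)`; at `(σ, Φ)`
with H1, the tail `CruxTailT` is fed per horizon by `cruxTailT_of_conclOn`: stub 1 gives the conjugacy identity at
`σ`, stubs 2 and 3 give the look-back and cylinder allowances `cI, cB ∈ [0, 1/2)` at `t`, the probabilistic core
gives contact entropic chaos with allowance `cI + cB ∈ [0, 1)`, stub 5 gives the Reynolds remainder, and stub 4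
closes. -/
theorem AdaptedWeightCLT_of
    (h1 : stub_conjugacy) (h2 : stub_lookBack) (h3 : stub_cylinderChaos)
    (h4 : stub_entropicClosure) (h5 : stub_reynolds) :
    Summit.AtomisticToContinuum.HydrodynamicLimit.Theses.CollisionIsometryCLT.AdaptedWeightCLT := by
  rw [adaptedWeightCLT_iff]
  intro a₀ θ₀ u₀ ha hθ hu ha0 hθ0
  have hP : NiceProfiles a₀ θ₀ u₀ := ⟨ha, hθ, hu, ha0, hθ0⟩
  obtain ⟨σ₂, hσ₂, H2⟩ := (h2 : type_of% Holds.stub_lookBack) a₀ θ₀ u₀ hP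
  obtain ⟨σ₃, hσ₃, H3⟩ := (h3 : type_of% Holds.stub_cylinderChaos) a₀ θ₀ u₀ hP
  obtain ⟨σ₅, hσ₅, H5⟩ := (h5 : type_of% Holds.stub_reynolds) a₀ θ₀ u₀ hP
  refine ⟨min (min σ₂ σ₃) (min σ₅ 2⁻¹), lt_min (lt_min hσ₂ hσ₃) (lt_min hσ₅ (by norm_num)), ?_⟩
  intro σ hσ hlt Φ hD
  have h2lt : σ < σ₂ := lt_of_lt_of_le hlt ((min_le_left _ _).trans (min_le_left _ _))
  have h3lt : σ < σ₃ := lt_of_lt_of_le hlt ((min_le_left _ _).trans (min_le_right _ _))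
  have h5lt : σ < σ₅ := lt_of_lt_of_le hlt ((min_le_right _ _).trans (min_le_left _ _))
  have hhalf : σ < 2⁻¹ := lt_of_lt_of_le hlt ((min_le_right _ _).trans (min_le_right _ _))
  have hCI : ConjugacyIdentity σ := (h1 : type_of% Holds.stub_conjugacy) σ hσ hhalf
  refine cruxTailT_of_conclOn fun t ht hT => ?_
  obtain ⟨cI, hcI0, hcI, HI⟩ := H2 σ hσ h2lt hCI Φ hD t ht hT
  obtain ⟨cB, hcB0, hcB, HB⟩ := H3 σ hσ h3lt Φ hD t ht hT
  have hR : SubBlockReynoldsOn σ a₀ θ₀ u₀ Φ t := H5 σ hσ h5lt Φ hD t ht hT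
  have hc0 : 0 ≤ cI + cB := add_nonneg hcI0 hcB0
  have hc : cI + cB < 1 := by
    have : (2⁻¹ : ℝ) + 2⁻¹ = 1 := by norm_num
    linarith
  exact (h4 : type_of% Holds.stub_entropicClosure) a₀ θ₀ u₀ hP σ hσ hhalf Φ t ht hT (cI + cB) hc0 hc
    (contactEntropicChaosOn_of_lookBack_of_cylinder HI HB) hR

/-- D-0027 §3.3 shape: the crux from the registered open stubs — an `example`, so that `AdaptedWeightCLT_of`
stays the unique theorem concluding the crux. -/
example : Summit.AtomisticToContinuum.HydrodynamicLimit.Theses.CollisionIsometryCLT.AdaptedWeightCLT :=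
  AdaptedWeightCLT_of Holds.stub_conjugacy Holds.stub_lookBack Holds.stub_cylinderChaos
    Holds.stub_entropicClosure Holds.stub_reynolds

end

end Summit.AtomisticToContinuum.HydrodynamicLimit.Cruxes.AdaptedWeightCLT.ApproachCylinderPullback
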